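import Summits.QuantumAdvantage.AdviceFreeQNC0.AffBells22FrameAveraging
import Summits.QuantumAdvantage.AdviceFreeQNC0.AffBells23RingCondProofs
import HarnessLib

/-!
# Sketch22 §2c: frame averaging with a COMMON junta set, and the rung `RingFrameJuntaCommonLt3`, proved

* `exists_frame_transversal_off` — for a frame that is `δ`-regular OFF `J₀` and `w₀`-junta parts `T_k`, a transversal of the
  enlarged reading sets `T_k ∪ J₀` inside `supp(tV) ∖ J₀` of size `≥ δ²N/(δ + w₀²)` (Turán / Caro–Wei; `J₀` is avoided, so only the
  `T_k` matter);
* `frameAveragingCommon` — THE domination theorem for tables reading `T_k ∪ J₀` with `J₀` ARBITRARY (no size bound is needed for the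
  error term): same constants as `frameAveraging`;
* `exists_polylog_le_quarter` — `(log₂ N)^C ≤ N/4` eventually (`TubePlanProof.logPow_le_natSqrt`);
* **`ringFrameJuntaCommonLt3 : RingFrameJuntaCommonLt3`** — the rung R-frame ⊗ junta with a common polylog junta set, unconditionally:
  the frozen strategies read `T_k ∪ J₀`, i.e. are junta ⊕ common-set strategies, killed by the (G1) theorem
  `AffBells23.juntaCommonHard2` (Sketch23 §3b, every `δ₀ < 1/2`; here `δ₀ = 1/4`), itself over the tree's `walkHardAllSubcube`.
  Since `juntaCommonHard2` allows `|J₀| ≤ N/4`, the polylog hypothesis of the rung is used only through `|J₀| ≤ N/4`.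

This removes "juntas on a common large set → conditioning" (ROUND-21 §4.7 open list) for `|J₀| ≤ polylog` — in fact for `|J₀| ≤ N/4`
with regularity off `J₀`.  Separation NOT moved.
-/

namespace Summit.QuantumAdvantage.AdviceFreeQNC0

open Finset Literature.Computability.QuantumComplexity Literature.Computability.QuantumComplexity.RingHLF
open Literature.Computability.MetaComplexity

namespace AffBells22

variable {N m : ℕ}

/-! ## Frame averaging with a common junta set `J₀` -/

/-- A transversal of the reading sets inside `supp(tV) ∖ J₀` of size `≥ δ²N/(δ + w₀²)`; it is automatically a transversal of the
enlarged reading sets `T_k ∪ J₀`. -/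
theorem exists_frame_transversal_off (hN : 0 < N) (V : Fin m → Fin N → ZMod 3) (J₀ : Finset (Fin N))
    (T : Fin N → Finset (Fin N)) {w₀ : ℕ} (hT : ∀ k, (T k).card ≤ w₀) {δ : ℝ} (hδ : 0 < δ) (t : Fin m → ZMod 3)
    (hreg : δ * N ≤ ((univ.filter fun i : Fin N => i ∉ J₀ ∧ (∑ l : Fin m, t l * V l i) ≠ 0).card : ℝ)) :
    ∃ A : Finset (Fin N), (∀ k, ((T k ∪ J₀) ∩ A).card ≤ 1) ∧ (∀ i ∈ A, (∑ l : Fin m, t l * V l i) ≠ 0) ∧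
      δ ^ 2 / (δ + (w₀ : ℝ) ^ 2) * N ≤ (A.card : ℝ) := by
  set P := univ.filter fun i : Fin N => i ∉ J₀ ∧ (∑ l : Fin m, t l * V l i) ≠ 0 with hP
  have hΛ : (∑ k ∈ (univ : Finset (Fin N)), ((T k).card : ℝ) * (((T k).card : ℝ) - 1)) ≤ N * (w₀ : ℝ) ^ 2 := by
    calc (∑ k ∈ (univ : Finset (Fin N)), ((T k).card : ℝ) * (((T k).card : ℝ) - 1))
        ≤ ∑ _k ∈ (univ : Finset (Fin N)), (w₀ : ℝ) ^ 2 := by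
          refine sum_le_sum fun k _ => ?_
          have h1 : ((T k).card : ℝ) ≤ w₀ := by exact_mod_cast hT k
          have h0 : (0 : ℝ) ≤ (T k).card := by positivity
          nlinarith
      _ = N * (w₀ : ℝ) ^ 2 := by rw [sum_const, card_univ, Fintype.card_fin, nsmul_eq_mul]
  obtain ⟨A, hAP, htr, hsize⟩ := AffBells23.exists_transversal_ge (univ : Finset (Fin N)) T P (w := δ * N)
    (by positivity) hreg hΛ
  refine ⟨A, fun k => ?_, fun i hi => (mem_filter.mp (hAP hi)).2.2, le_trans (le_of_eq ?_) hsize⟩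
  · -- `A` avoids `J₀`, so `(T k ∪ J₀) ∩ A = T k ∩ A`
    have : (T k ∪ J₀) ∩ A = T k ∩ A := by
      ext i
      simp only [mem_inter, mem_union]
      constructor
      · rintro ⟨h | h, hiA⟩
        · exact ⟨h, hiA⟩
        · exact absurd h (mem_filter.mp (hAP hiA)).2.1
      · rintro ⟨h, hiA⟩
        exact ⟨Or.inl h, hiA⟩
    rw [this]
    exact htr k (mem_univ k)
  · have hN' : (0 : ℝ) < N := by exact_mod_cast hN
    field_simp

/-- **FRAME AVERAGING WITH A COMMON JUNTA SET**: tables reading `T_k ∪ J₀` (`|T_k| ≤ w₀`, `J₀` ARBITRARY), frame `δ`-regular OFF `J₀`;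
same conclusion and constants as `frameAveraging` (the transversal is chosen inside `supp(tV) ∖ J₀`, where the enlarged reading sets
meet it only through `T_k`). -/
theorem frameAveragingCommon :
    ∀ δ : ℝ, 0 < δ → ∀ w₀ : ℕ, ∀ ε : ℝ, 0 < ε → ∃ μ₀ : ℝ, 0 < μ₀ ∧ ∃ n₀ : ℕ, ∀ N ≥ n₀, ∀ m : ℕ, (m : ℝ) ≤ μ₀ * N →
      ∀ (V : Fin m → Fin N → ZMod 3) (J₀ : Finset (Fin N)) (T : Fin N → Finset (Fin N))
        (τ : Fin N → (Fin m → ZMod 3) → (Fin N → Bool) → Bool),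
        (∀ t : Fin m → ZMod 3, t ≠ 0 →
          δ * N ≤ ((univ.filter fun i : Fin N => i ∉ J₀ ∧ (∑ l : Fin m, t l * V l i) ≠ 0).card : ℝ)) →
        (∀ k, (T k).card ≤ w₀) → (∀ k y, ReadsOnly (T k ∪ J₀) (τ k y)) →
        (winCount (frameJuntaBell V τ) : ℝ)
          ≤ (∑ u : Fin m → ZMod 3, (winCount (frozenBell τ u) : ℝ)) / (3 : ℝ) ^ m + ε * (2 : ℝ) ^ (N - 1) := by
  intro δ hδ w₀ ε hε
  have hlog : 0 < Real.log (40 / 39) := Real.log_pos (by norm_num)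
  have hlog3 : 0 < Real.log 3 := Real.log_pos (by norm_num)
  set δ' : ℝ := δ ^ 2 / (δ + (w₀ : ℝ) ^ 2) with hδ'
  have hδ'0 : 0 < δ' := by positivity
  set a : ℝ := δ' * Real.log (40 / 39) / 2 with ha
  have ha0 : 0 < a := by positivity
  refine ⟨a / Real.log 3, by positivity, max 3 ⌈(100 / 39) / (ε * a)⌉₊, fun N hN m hm V J₀ T τ hV hT hτ => ?_⟩
  have hN3 : 3 ≤ N := le_trans (le_max_left _ _) hN
  have hNceil : (100 / 39) / (ε * a) ≤ N :=
    le_trans (Nat.le_ceil _) (by exact_mod_cast le_trans (le_max_right _ _) hN)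
  refine (frame_domination hN3 V τ).trans (add_le_add le_rfl ?_)
  have hterm : ∀ t ∈ (univ : Finset (Fin m → ZMod 3)).erase 0,
      ‖∑ x ∈ (univ : Finset (Fin N → Bool)).filter (fun x => Fib19.IsOdd x),
          fhat m (frozenSign τ x) t * (ZMod.stdAddChar (∑ l : Fin m, t l * frameVal V x l) : ℂ)‖
        ≤ 200 / 39 * Real.exp (-(2 * a * N)) * (2 : ℝ) ^ (N - 1) := by
    intro t ht
    have ht0 : t ≠ 0 := (mem_erase.mp ht).1
    obtain ⟨A, hA, hAγ, hsize⟩ := exists_frame_transversal_off (by omega) V J₀ T hT hδ t (hV t ht0)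
    refine (norm_errorTerm_le_junta hN3 V (fun k => T k ∪ J₀) τ hτ t A hA hAγ).trans ?_
    have hk : (39 / 40 : ℝ) ^ A.card ≤ Real.exp (-(2 * a * N)) := by
      rw [← Real.exp_log (show (0 : ℝ) < 39 / 40 by norm_num), ← Real.exp_nat_mul, Real.exp_le_exp]
      have hl : Real.log (39 / 40) = -Real.log (40 / 39) := by
        rw [← Real.log_inv]; norm_num
      rw [hl, ha]
      have := mul_le_mul_of_nonneg_right hsize hlog.le
      linarith
    gcongr
  have hcard : (((univ : Finset (Fin m → ZMod 3)).erase 0).card : ℝ) ≤ (3 : ℝ) ^ m := by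
    have h : ((univ : Finset (Fin m → ZMod 3)).erase 0).card ≤ 3 ^ m := by
      rw [card_erase_of_mem (mem_univ _), card_univ, card_frame]; exact Nat.sub_le _ _
    exact_mod_cast h
  have h3m : (3 : ℝ) ^ m ≤ Real.exp (a * N) := by
    have : (3 : ℝ) ^ m = Real.exp (m * Real.log 3) := by rw [Real.exp_nat_mul, Real.exp_log (by norm_num)]
    rw [this, Real.exp_le_exp]
    calc (m : ℝ) * Real.log 3 ≤ a / Real.log 3 * N * Real.log 3 := mul_le_mul_of_nonneg_right hm hlog3.le
      _ = a * N := by field_simp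
  have hfin : 100 / 39 * Real.exp (-(a * N)) ≤ ε := by
    have h1 := exp_neg_le_one_div (s := a * N) (by positivity)
    have h2 : 100 / 39 ≤ ε * a * N := by
      rw [div_le_iff₀ (by positivity)] at hNceil; linarith
    calc 100 / 39 * Real.exp (-(a * N)) ≤ 100 / 39 * (1 / (a * N + 1)) := by gcongr
      _ ≤ ε := by
          rw [← mul_div_assoc, mul_one, div_le_iff₀ (by positivity)]
          nlinarith [hε.le]
  have h2N : (0 : ℝ) ≤ (2 : ℝ) ^ (N - 1) := by positivity
  calc (1 / 2 : ℝ) * ∑ t ∈ (univ : Finset (Fin m → ZMod 3)).erase 0,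
          ‖∑ x ∈ (univ : Finset (Fin N → Bool)).filter (fun x => Fib19.IsOdd x),
            fhat m (frozenSign τ x) t * (ZMod.stdAddChar (∑ l : Fin m, t l * frameVal V x l) : ℂ)‖
      ≤ (1 / 2 : ℝ) * ∑ _t ∈ (univ : Finset (Fin m → ZMod 3)).erase 0,
          (200 / 39 * Real.exp (-(2 * a * N)) * (2 : ℝ) ^ (N - 1)) :=
        mul_le_mul_of_nonneg_left (sum_le_sum hterm) (by norm_num)
    _ = (1 / 2 : ℝ) * ((((univ : Finset (Fin m → ZMod 3)).erase 0).card : ℝ)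
          * (200 / 39 * Real.exp (-(2 * a * N)) * (2 : ℝ) ^ (N - 1))) := by rw [sum_const, nsmul_eq_mul]
    _ ≤ (1 / 2 : ℝ) * ((3 : ℝ) ^ m * (200 / 39 * Real.exp (-(2 * a * N)) * (2 : ℝ) ^ (N - 1))) := by gcongr
    _ ≤ (1 / 2 : ℝ) * (Real.exp (a * N) * (200 / 39 * Real.exp (-(2 * a * N)) * (2 : ℝ) ^ (N - 1))) := by gcongr
    _ = 100 / 39 * (Real.exp (a * N) * Real.exp (-(2 * a * N))) * (2 : ℝ) ^ (N - 1) := by ring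
    _ = 100 / 39 * Real.exp (-(a * N)) * (2 : ℝ) ^ (N - 1) := by
        rw [← Real.exp_add]; congr 2; ring_nf
    _ ≤ ε * (2 : ℝ) ^ (N - 1) := mul_le_mul_of_nonneg_right hfin h2N

/-- Polylog is eventually below a quarter: `|J₀| ≤ (log₂ N)^C ⇒ |J₀| ≤ N/4` for `N ≥ n₀(C)`. -/
theorem exists_polylog_le_quarter (C : ℕ) : ∃ n₀ : ℕ, ∀ N ≥ n₀, ∀ J₀ : Finset (Fin N),
    J₀.card ≤ (Nat.log 2 N) ^ C → (J₀.card : ℝ) ≤ 1 / 4 * N := by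
  obtain ⟨n₃, hn₃⟩ := TubePlanProof.logPow_le_natSqrt C
  refine ⟨max n₃ 16, fun N hN J₀ hJ₀ => ?_⟩
  have h1 : J₀.card ≤ Nat.sqrt N := hJ₀.trans (hn₃ N (le_trans (le_max_left _ _) hN))
  have h4 : 4 ≤ Nat.sqrt N := Nat.le_sqrt.mpr (le_trans (le_max_right _ _) hN)
  have h2 : 4 * J₀.card ≤ N :=
    calc 4 * J₀.card ≤ Nat.sqrt N * Nat.sqrt N := Nat.mul_le_mul h4 h1
      _ ≤ N := Nat.sqrt_le N
  have h3 : (4 : ℝ) * J₀.card ≤ N := by exact_mod_cast h2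
  linarith

/-- **RUNG `RingFrameJuntaCommonLt3` (R-frame ⊗ junta with a COMMON polylog junta set) PROVED**, unconditionally:
`frameAveragingCommon` + the unconditional (G1) theorem `AffBells23.juntaCommonHard2` (junta ⊕ common set of `≤ N/4` inputs,
planner qn-p1 g23 / Sketch23, over the tree's `walkHardAllSubcube`) for the frozen strategies. -/
theorem ringFrameJuntaCommonLt3 : RingFrameJuntaCommonLt3 := by
  intro δ hδ w₀ C
  obtain ⟨θ₂, hθ₂, hj⟩ := AffBells23.juntaCommonHard2 (1 / 4) (by norm_num)
  obtain ⟨n₁, hn₁⟩ := hj w₀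
  set ε : ℝ := (1 - θ₂) / 2 with hε
  have hεpos : 0 < ε := by rw [hε]; linarith
  obtain ⟨μ₀, hμ₀, n₂, hn₂⟩ := frameAveragingCommon δ hδ w₀ ε hεpos
  obtain ⟨n₃, hn₃⟩ := exists_polylog_le_quarter C
  refine ⟨μ₀, hμ₀, θ₂ + ε, by rw [hε]; linarith, max (max n₁ n₂) n₃,
    fun N hN m hm V J₀ T τ hJ₀ hreg hT hread => ?_⟩
  have hN₁ : n₁ ≤ N := le_trans (le_trans (le_max_left _ _) (le_max_left _ _)) hN
  have hN₂ : n₂ ≤ N := le_trans (le_trans (le_max_right _ _) (le_max_left _ _)) hN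
  have hN₃ : n₃ ≤ N := le_trans (le_max_right _ _) hN
  have hJ₀' : (J₀.card : ℝ) ≤ 1 / 4 * N := hn₃ N hN₃ J₀ hJ₀
  have havg := hn₂ N hN₂ m hm V J₀ T τ hreg hT hread
  have hfrozen : ∀ u : Fin m → ZMod 3, (winCount (frozenBell τ u) : ℝ) ≤ θ₂ * (2 : ℝ) ^ (N - 1) :=
    fun u => hn₁ N hN₁ J₀ T (fun k => τ k u) hJ₀' hT (fun k => hread k u)
  have hsum : (∑ u : Fin m → ZMod 3, (winCount (frozenBell τ u) : ℝ)) / (3 : ℝ) ^ m ≤ θ₂ * (2 : ℝ) ^ (N - 1) := by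
    rw [div_le_iff₀ (by positivity)]
    calc ∑ u : Fin m → ZMod 3, (winCount (frozenBell τ u) : ℝ)
        ≤ ∑ _u : Fin m → ZMod 3, θ₂ * (2 : ℝ) ^ (N - 1) := sum_le_sum fun u _ => hfrozen u
      _ = θ₂ * (2 : ℝ) ^ (N - 1) * (3 : ℝ) ^ m := by
          rw [sum_const, card_univ, card_frame, nsmul_eq_mul]
          push_cast
          ring
  calc (winCount (frameJuntaBell V τ) : ℝ)
      ≤ (∑ u : Fin m → ZMod 3, (winCount (frozenBell τ u) : ℝ)) / (3 : ℝ) ^ m + ε * (2 : ℝ) ^ (N - 1) := havg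
    _ ≤ θ₂ * (2 : ℝ) ^ (N - 1) + ε * (2 : ℝ) ^ (N - 1) := by linarith
    _ = (θ₂ + ε) * (2 : ℝ) ^ (N - 1) := by ring

end AffBells22

end Summit.QuantumAdvantage.AdviceFreeQNC0
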